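import Literature.MathematicalPhysics.KineticTheory.InfiniteChainSevered
import HarnessLib

/-!
# Severed flows preserve the Gibbs states of the chain (Lanford–Lebowitz–Lieb 1977, §4 (i))

LLL 1977, §4, remark (i) (p. 459): "by conservation of energy and Liouville's theorem, any Gibbs
state is invariant under `T_t^α` for all `α, t`". This file proves it for the nearest-neighbour
chain `P : OscillatorChain` under A2 (`U, V ∈ C²`) and B1:

* `hamiltonianIn_chain` — the finite-volume Hamiltonian `H_Λ` of `chainSpecification`
  (`Literature.Probability.LatticeModels.hamiltonianIn` of `chainPotential`/`chainSupp`) is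
  `∑_{x∈Λ} (½p_x² + U(q_x)) + ∑_{y ∈ Λ ∪ (Λ-1)} V(q_{y+1} - q_y)` (LLL (10));
* `IsSeveredSolution.hamiltonianIn_eq` — **conservation of `H_Λ`** along severed solutions;
* `map_glueWith_eq_map_embed` — the a priori measure `(dq dp)^{⊗Λ} ⊗ δ_η` of the Gibbs kernel is
  the image of Lebesgue measure on `PhaseSpace m` under `embed`;
* `measurePreserving_severedFlow_chainSpecification` — **each finite-volume Gibbs distribution
  `γ_Λ(· | η)` (LLL (14)) is invariant under `T_t^Λ`** (Liouville on the fibre,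
  `NewtonianFlow.IsSolutionFamily.measurePreserving`, + conservation of energy);
* `measurePreserving_severedFlow_of_isChainGibbsMeasure` — **every Gibbs state `μ` is invariant
  under every `T_t^Λ`** (DLR equations). [cite: LanfordLebowitzLieb1977, §4 remark (i)]
-/

noncomputable section

open MeasureTheory Filter Topology Set Literature.Probability.LatticeModels
open scoped ContDiff ENNReal

namespace Literature.MathematicalPhysics.KineticTheory.HeatConduction

namespace OscillatorChain

variable (P : OscillatorChain)

/-! ### The finite-volume Hamiltonian of the chain -/

/-- The left endpoints of the bonds meeting `Λ`: `y` with `{y, y+1} ∩ Λ ≠ ∅`, i.e.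
`y ∈ Λ ∪ (Λ - 1)`. [folklore] -/
def bondSet (Λ : Finset ℤ) : Finset ℤ := Λ ∪ Λ.image (fun x => x - 1)

omit P in
/-- `Λ ⊆ bondSet Λ`. [folklore] -/
theorem subset_bondSet (Λ : Finset ℤ) : Λ ⊆ bondSet Λ := Finset.subset_union_left

omit P in
/-- `Λ - 1 ⊆ bondSet Λ`. [folklore] -/
theorem image_sub_one_subset_bondSet (Λ : Finset ℤ) : Λ.image (fun x => x - 1) ⊆ bondSet Λ :=
  Finset.subset_union_right

omit P in
/-- The bond map `y ↦ {y, y+1}` is injective. [folklore] -/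
theorem pair_injective : Function.Injective fun y : ℤ => ({y, y + 1} : Finset ℤ) := by
  intro y y' h
  have hy : y ∈ ({y', y' + 1} : Finset ℤ) := by
    rw [← show ({y, y + 1} : Finset ℤ) = {y', y' + 1} from h]; simp
  have hy' : y' ∈ ({y, y + 1} : Finset ℤ) := by
    rw [show ({y, y + 1} : Finset ℤ) = {y', y' + 1} from h]; simp
  simp only [Finset.mem_insert, Finset.mem_singleton] at hy hy'
  omega

omit P in
/-- The interaction sets of the chain meeting `Λ`: the sites of `Λ` and the bonds `{y, y+1}`,
`y ∈ bondSet Λ`. [folklore] -/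
theorem chainSupp_eq (Λ : Finset ℤ) :
    chainSupp Λ = Λ.image (fun x => ({x} : Finset ℤ)) ∪
      (bondSet Λ).image (fun y => ({y, y + 1} : Finset ℤ)) := by
  have h3 : Λ.image (fun x => ({x - 1, x} : Finset ℤ)) =
      (Λ.image (fun x => x - 1)).image (fun y => ({y, y + 1} : Finset ℤ)) := by
    rw [Finset.image_image]
    refine Finset.image_congr fun x _ => ?_
    simp
  rw [chainSupp, bondSet, Finset.image_union, h3, Finset.union_assoc]

omit P in
/-- Every interaction set in `chainSupp Λ` meets `Λ`. [folklore] -/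
theorem inter_nonempty_of_mem_chainSupp {Λ A : Finset ℤ} (hA : A ∈ chainSupp Λ) :
    (A ∩ Λ).Nonempty := by
  simp only [chainSupp, Finset.mem_union, Finset.mem_image] at hA
  rcases hA with (⟨x, hx, rfl⟩ | ⟨x, hx, rfl⟩) | ⟨x, hx, rfl⟩
  · exact ⟨x, by simp [hx]⟩
  · exact ⟨x, by simp [hx]⟩
  · exact ⟨x, by simp [hx]⟩

/-- **The finite-volume Hamiltonian of the chain** (LLL (10) with `U_i = U`,
`V_j = V(q_{j+1} - q_j)`): `H_Λ(σ) = ∑_{x∈Λ} (½ p_x² + U(q_x)) + ∑_{y ∈ Λ ∪ (Λ-1)} V(q_{y+1} - q_y)`.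
[cite: LanfordLebowitzLieb1977, §2 eq. (10)] -/
theorem hamiltonianIn_chain (Λ : Finset ℤ) (σ : ChainConfig) :
    hamiltonianIn P.chainPotential chainSupp Λ σ =
      ∑ x ∈ Λ, ((σ x).2 ^ 2 / 2 + P.U (σ x).1) +
        ∑ y ∈ bondSet Λ, P.V ((σ (y + 1)).1 - (σ y).1) := by
  unfold hamiltonianIn
  rw [Finset.filter_true_of_mem fun A hA => inter_nonempty_of_mem_chainSupp hA, chainSupp_eq]
  have hdisj : Disjoint (Λ.image (fun x => ({x} : Finset ℤ)))
      ((bondSet Λ).image (fun y => ({y, y + 1} : Finset ℤ))) := by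
    rw [Finset.disjoint_left]
    intro A hA hA'
    simp only [Finset.mem_image] at hA hA'
    obtain ⟨x, _, rfl⟩ := hA
    obtain ⟨y, _, hy⟩ := hA'
    have h1 : ({y, y + 1} : Finset ℤ).card = 2 := Finset.card_pair (by omega)
    rw [hy, Finset.card_singleton] at h1
    exact absurd h1 (by norm_num)
  rw [Finset.sum_union hdisj, Finset.sum_image fun x _ y _ h => Finset.singleton_injective h,
    Finset.sum_image fun x _ y _ h => pair_injective h]
  simp only [chainPotential_singleton, chainPotential_pair]

/-- The finite-volume Hamiltonian is a continuous function of the configuration. [folklore] -/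
theorem continuous_hamiltonianIn_chain (hU : Continuous P.U) (hV : Continuous P.V) (Λ : Finset ℤ) :
    Continuous fun σ : ChainConfig => hamiltonianIn P.chainPotential chainSupp Λ σ := by
  simp only [hamiltonianIn_chain]
  fun_prop

/-! ### Conservation of energy along severed solutions -/

/-- **Conservation of `H_Λ` under the severed dynamics** (LLL, proof of Thm 1: "The time
evolution mappings `T_t^α` … leave invariant the energy in `Λ_α`"). [cite: LanfordLebowitzLieb1977, §2 after eqs. (9a)–(9c)] -/
theorem IsSeveredSolution.hamiltonianIn_eq {P : OscillatorChain} (hU : ContDiff ℝ 2 P.U)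
    (hV : ContDiff ℝ 2 P.V) {Λ : Finset ℤ} {γ : ℝ → ChainConfig}
    (hγ : P.IsSeveredSolution Λ γ) (t : ℝ) :
    hamiltonianIn P.chainPotential chainSupp Λ (γ t) =
      hamiltonianIn P.chainPotential chainSupp Λ (γ 0) := by
  have hUd : ∀ x, HasDerivAt P.U (deriv P.U x) x := fun x =>
    ((hU.differentiable (by norm_num)) x).hasDerivAt
  have hVd : ∀ x, HasDerivAt P.V (deriv P.V x) x := fun x =>
    ((hV.differentiable (by norm_num)) x).hasDerivAt
  set g : ℝ → ℝ := fun s => hamiltonianIn P.chainPotential chainSupp Λ (γ s) with hg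
  -- derivative of `g` vanishes
  have hderiv : ∀ s, HasDerivAt g 0 s := by
    intro s
    -- velocities
    set d : ℤ → ℝ := fun j => if j ∈ Λ then (γ s j).2 else 0 with hd
    have hq : ∀ j, HasDerivAt (fun u => (γ u j).1) (d j) s := by
      intro j
      by_cases hj : j ∈ Λ
      · simp only [hd, hj, if_true]
        exact (hγ.1 j hj s).1
      · simp only [hd, hj, if_false]
        have : (fun u => (γ u j).1) = fun _ => (γ 0 j).1 := by
          funext u; rw [hγ.2 j hj u]
        rw [this]
        exact hasDerivAt_const s _
    have hp : ∀ j ∈ Λ, HasDerivAt (fun u => (γ u j).2) (P.force (γ s) j) s :=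
      fun j hj => (hγ.1 j hj s).2
    -- bond variables
    set b : ℤ → ℝ := fun y => (γ s (y + 1)).1 - (γ s y).1 with hb
    -- site terms
    have hsite : ∀ x ∈ Λ, HasDerivAt (fun u => (γ u x).2 ^ 2 / 2 + P.U (γ u x).1)
        ((γ s x).2 * (deriv P.V (b x) - deriv P.V (b (x - 1)))) s := by
      intro x hx
      have h1 := ((hp x hx).pow 2).div_const 2
      have h2 := (hUd _).comp s (hq x)
      refine (h1.add h2).congr_deriv ?_
      simp only [hd, hx, if_true, hb, sub_add_cancel, force_eq]
      push_cast
      ring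
    -- bond terms
    have hbond : ∀ y ∈ bondSet Λ, HasDerivAt (fun u => P.V ((γ u (y + 1)).1 - (γ u y).1))
        (deriv P.V (b y) * (d (y + 1) - d y)) s := by
      intro y _
      exact (hVd _).comp s ((hq (y + 1)).sub (hq y))
    have hsum := (HasDerivAt.fun_sum hsite).add (HasDerivAt.fun_sum hbond)
    have hfun : g = fun u => ∑ x ∈ Λ, ((γ u x).2 ^ 2 / 2 + P.U (γ u x).1) +
        ∑ y ∈ bondSet Λ, P.V ((γ u (y + 1)).1 - (γ u y).1) := by
      funext u; simp only [hg, hamiltonianIn_chain]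
    rw [hfun]
    refine hsum.congr_deriv ?_
    -- the algebra: the sum vanishes
    have hI : ∑ y ∈ bondSet Λ, deriv P.V (b y) * d y = ∑ y ∈ Λ, deriv P.V (b y) * (γ s y).2 := by
      have : ∀ y, deriv P.V (b y) * d y = if y ∈ Λ then deriv P.V (b y) * (γ s y).2 else 0 := by
        intro y; simp only [hd]; split_ifs <;> simp
      simp_rw [this]
      rw [← Finset.sum_filter, Finset.filter_mem_eq_inter,
        Finset.inter_eq_right.2 (subset_bondSet Λ)]
    have hII : ∑ y ∈ bondSet Λ, deriv P.V (b y) * d (y + 1) =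
        ∑ x ∈ Λ, deriv P.V (b (x - 1)) * (γ s x).2 := by
      have : ∀ y, deriv P.V (b y) * d (y + 1) =
          if y + 1 ∈ Λ then deriv P.V (b y) * (γ s (y + 1)).2 else 0 := by
        intro y; simp only [hd]; split_ifs <;> simp
      simp_rw [this]
      rw [← Finset.sum_filter]
      have hfilter : (bondSet Λ).filter (fun y => y + 1 ∈ Λ) = Λ.image (fun x => x - 1) := by
        ext y
        simp only [Finset.mem_filter, Finset.mem_image, bondSet, Finset.mem_union]
        constructor
        · rintro ⟨_, hy⟩
          exact ⟨y + 1, hy, by ring⟩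
        · rintro ⟨x, hx, rfl⟩
          exact ⟨Or.inr ⟨x, hx, rfl⟩, by simpa using hx⟩
      rw [hfilter, Finset.sum_image fun x _ y _ h => by simpa using h]
      refine Finset.sum_congr rfl fun x _ => ?_
      simp
    have hsplit : ∑ y ∈ bondSet Λ, deriv P.V (b y) * (d (y + 1) - d y) =
        ∑ x ∈ Λ, deriv P.V (b (x - 1)) * (γ s x).2 - ∑ y ∈ Λ, deriv P.V (b y) * (γ s y).2 := by
      rw [← hI, ← hII, ← Finset.sum_sub_distrib]
      refine Finset.sum_congr rfl fun y _ => ?_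
      ring
    rw [hsplit, ← Finset.sum_sub_distrib, ← Finset.sum_add_distrib]
    refine Finset.sum_eq_zero fun x _ => ?_
    ring
  have hdiff : Differentiable ℝ g := fun s => (hderiv s).differentiableAt
  exact is_const_of_deriv_eq_zero hdiff (fun s => (hderiv s).deriv) t 0

/-- Conservation of `H_Λ` under the severed flow. [cite: LanfordLebowitzLieb1977, §2 after eqs. (9a)–(9c)] -/
theorem hamiltonianIn_severedFlow {P : OscillatorChain} (hU : ContDiff ℝ 2 P.U)
    (hV : ContDiff ℝ 2 P.V) (hB1 : P.CondB1) (Λ : Finset ℤ) (t : ℝ) (σ : ChainConfig) :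
    hamiltonianIn P.chainPotential chainSupp Λ (severedFlow hB1 Λ t σ) =
      hamiltonianIn P.chainPotential chainSupp Λ σ := by
  have h := (isSeveredSolution_severedFlow hB1 Λ σ).hamiltonianIn_eq hU hV t
  simpa using h

/-! ### The a priori measure of the Gibbs kernel on the fibre -/

section Fibre

variable {P} {Λ : Finset ℤ} {m : ℕ} (e : Fin m ≃ Λ)

omit P in
/-- The coordinate change `(Λ → ℝ × ℝ) ≃ᵐ PhaseSpace m` along the enumeration `e`. [folklore] -/
def fibreEquiv : (Λ → ℝ × ℝ) ≃ᵐ PhaseSpace m :=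
  (MeasurableEquiv.piCongrLeft (fun _ : Λ => ℝ × ℝ) e).symm.trans
    (MeasurableEquiv.arrowProdEquivProdArrow ℝ ℝ (Fin m))

omit P in
/-- The coordinate change in coordinates. [folklore] -/
theorem fibreEquiv_apply (ζ : Λ → ℝ × ℝ) :
    fibreEquiv e ζ = (fun k => (ζ (e k)).1, fun k => (ζ (e k)).2) := by
  ext k
  · simp [fibreEquiv, MeasurableEquiv.piCongrLeft, MeasurableEquiv.arrowProdEquivProdArrow,
      Equiv.arrowProdEquivProdArrow, MeasurableEquiv.trans]
  · simp [fibreEquiv, MeasurableEquiv.piCongrLeft, MeasurableEquiv.arrowProdEquivProdArrow,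
      Equiv.arrowProdEquivProdArrow, MeasurableEquiv.trans]

omit P in
/-- The coordinate change carries `(dq dp)^{⊗Λ}` to Lebesgue measure on `PhaseSpace m`.
[folklore] -/
theorem measurePreserving_fibreEquiv :
    MeasurePreserving (fibreEquiv e) (Measure.pi fun _ : Λ => (volume : Measure (ℝ × ℝ)))
      volume := by
  have h1 := (measurePreserving_piCongrLeft (fun _ : Λ => (volume : Measure (ℝ × ℝ))) e).symm
  have h2 := volume_measurePreserving_arrowProdEquivProdArrow ℝ ℝ (Fin m)
  exact h2.comp h1

omit P in
/-- `glueWith = embed ∘ fibreEquiv`. [folklore] -/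
theorem glueWith_eq_embed_fibreEquiv (η : ChainConfig) (ζ : Λ → ℝ × ℝ) :
    glueWith Λ ζ η = embed Λ e η (fibreEquiv e ζ) := by
  funext j
  by_cases hj : j ∈ Λ
  · rw [glueWith_apply_mem Λ ζ η hj, embed_apply_of_mem η _ hj, fibreEquiv_apply]
    simp
  · rw [glueWith_apply_not_mem Λ ζ η hj, embed_apply_of_not_mem η _ hj]

omit P in
/-- **The a priori measure of the Gibbs kernel is the image of Lebesgue measure on the fibre**:
`(dq dp)^{⊗Λ} ∘ glueWith(·, η)⁻¹ = vol_{ℝ^m × ℝ^m} ∘ (embed η)⁻¹`. [folklore] -/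
theorem map_glueWith_eq_map_embed (η : ChainConfig) :
    (Measure.pi fun _ : Λ => (volume : Measure (ℝ × ℝ))).map (glueWith Λ · η) =
      (volume : Measure (PhaseSpace m)).map (embed Λ e η) := by
  have hfun : (glueWith Λ · η) = embed Λ e η ∘ fibreEquiv e := by
    funext ζ; exact glueWith_eq_embed_fibreEquiv e η ζ
  rw [hfun, ← Measure.map_map (measurable_embed η) (fibreEquiv e).measurable,
    (measurePreserving_fibreEquiv e).map_eq]

end Fibre

/-! ### Invariance of the Gibbs kernels and of Gibbs states -/

omit P in
/-- A measure-preserving self-map that leaves a density invariant preserves the weighted measure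
(deliberate dot-notation extension of Mathlib's `MeasureTheory.MeasurePreserving`, declared in
that namespace; Mathlib has no such lemma at the pinned version). [folklore] -/
theorem _root_.MeasureTheory.MeasurePreserving.withDensity_of_comp_eq {α : Type*}
    [MeasurableSpace α] {T : α → α} {ν : Measure α} (h : MeasurePreserving T ν ν)
    {ρ : α → ℝ≥0∞} (hρ : Measurable ρ) (hinv : ∀ x, ρ (T x) = ρ x) :
    MeasurePreserving T (ν.withDensity ρ) (ν.withDensity ρ) := by
  refine ⟨h.measurable, Measure.ext fun s hs => ?_⟩
  rw [Measure.map_apply h.measurable hs, withDensity_apply _ (hs.preimage h.measurable),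
    withDensity_apply _ hs]
  calc ∫⁻ x in T ⁻¹' s, ρ x ∂ν = ∫⁻ x in T ⁻¹' s, ρ (T x) ∂ν := by simp_rw [hinv]
    _ = ∫⁻ x in s, ρ x ∂ν := h.setLIntegral_comp_preimage hs hρ

/-- The a priori measure `(dq dp)^{⊗Λ} ⊗ δ_η` is invariant under the severed flow (Liouville on
the fibre). [cite: LanfordLebowitzLieb1977, §4 remark (i)] -/
theorem measurePreserving_severedFlow_map_glueWith {P : OscillatorChain} (hU : ContDiff ℝ 2 P.U)
    (hV : ContDiff ℝ 2 P.V) (hB1 : P.CondB1) (Λ : Finset ℤ) (η : ChainConfig) (t : ℝ) :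
    MeasurePreserving (severedFlow hB1 Λ t)
      ((Measure.pi fun _ : Λ => (volume : Measure (ℝ × ℝ))).map (glueWith Λ · η))
      ((Measure.pi fun _ : Λ => (volume : Measure (ℝ × ℝ))).map (glueWith Λ · η)) := by
  set e : Fin (Fintype.card Λ) ≃ Λ := (Fintype.equivFin Λ).symm
  have hT := measurable_severedFlow hB1 Λ hU hV t
  have hφ := (isSolutionFamily_fibreFlow hB1 Λ e η).measurePreserving
    (contDiff_sevForce P hU hV η) t
  rw [map_glueWith_eq_map_embed e]
  refine ⟨hT, ?_⟩
  have hcomm : severedFlow hB1 Λ t ∘ embed Λ e η = embed Λ e η ∘ fibreFlow hB1 Λ e η t := by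
    funext z; exact severedFlow_embed hB1 Λ e η t z
  rw [Measure.map_map hT (measurable_embed η), hcomm,
    ← Measure.map_map (measurable_embed η) hφ.measurable, hφ.map_eq]

/-- **LLL 1977, §4 remark (i), finite-volume form**: every finite-volume Gibbs distribution
`γ_Λ(· | η)` of the chain (`chainSpecification`, LLL (14)) is invariant under the severed flow
`T_t^Λ` — Liouville's theorem on the fibre and conservation of `H_Λ`. [cite: LanfordLebowitzLieb1977, §4 remark (i)] -/
theorem measurePreserving_severedFlow_chainSpecification {P : OscillatorChain}
    (hU : ContDiff ℝ 2 P.U) (hV : ContDiff ℝ 2 P.V) (hB1 : P.CondB1) (T : ℝ) (Λ : Finset ℤ)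
    (η : ChainConfig) (t : ℝ) :
    MeasurePreserving (severedFlow hB1 Λ t) (P.chainSpecification T Λ η)
      (P.chainSpecification T Λ η) := by
  have hν := measurePreserving_severedFlow_map_glueWith hU hV hB1 Λ η t
  change MeasurePreserving (severedFlow hB1 Λ t)
    (((Measure.pi fun _ : Λ => (volume : Measure (ℝ × ℝ))).map (glueWith Λ · η)).tilted
      fun σ => -T⁻¹ * hamiltonianIn P.chainPotential chainSupp Λ σ)
    (((Measure.pi fun _ : Λ => (volume : Measure (ℝ × ℝ))).map (glueWith Λ · η)).tilted
      fun σ => -T⁻¹ * hamiltonianIn P.chainPotential chainSupp Λ σ)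
  unfold Measure.tilted
  refine hν.withDensity_of_comp_eq ?_ fun σ => ?_
  · have hc := continuous_hamiltonianIn_chain P hU.continuous hV.continuous Λ
    exact ENNReal.measurable_ofReal.comp
      ((Real.measurable_exp.comp ((hc.measurable).const_mul _)).div_const _)
  · dsimp only
    rw [hamiltonianIn_severedFlow hU hV hB1 Λ t σ]

/-- **LLL 1977, §4 remark (i): every Gibbs state of the chain is invariant under every severed
flow `T_t^Λ`** (A2, B1; from the finite-volume form and the DLR equations). [cite: LanfordLebowitzLieb1977, §4 remark (i)] -/
theorem measurePreserving_severedFlow_of_isChainGibbsMeasure {P : OscillatorChain}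
    (hU : ContDiff ℝ 2 P.U) (hV : ContDiff ℝ 2 P.V) (hB1 : P.CondB1) (Λ : Finset ℤ) {T : ℝ}
    {μ : Measure ChainConfig} (hμ : P.IsChainGibbsMeasure T μ) (t : ℝ) :
    MeasurePreserving (severedFlow hB1 Λ t) μ μ := by
  have hT := measurable_severedFlow hB1 Λ hU hV t
  refine ⟨hT, Measure.ext fun A hA => ?_⟩
  rw [Measure.map_apply hT hA, ← hμ.2 Λ _ (hA.preimage hT), ← hμ.2 Λ A hA]
  refine lintegral_congr fun η => ?_
  exact (measurePreserving_severedFlow_chainSpecification hU hV hB1 T Λ η t).measure_preimage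
    hA.nullMeasurableSet

/-- Invariance in integrated form: `∫ F ∘ T_t^Λ dμ = ∫ F dμ` for measurable `F ≥ 0` and any Gibbs
state `μ`. [cite: LanfordLebowitzLieb1977, §4 remark (i)] -/
theorem lintegral_comp_severedFlow_of_isChainGibbsMeasure {P : OscillatorChain}
    (hU : ContDiff ℝ 2 P.U) (hV : ContDiff ℝ 2 P.V) (hB1 : P.CondB1) (Λ : Finset ℤ) {T : ℝ}
    {μ : Measure ChainConfig} (hμ : P.IsChainGibbsMeasure T μ) (t : ℝ)
    {F : ChainConfig → ℝ≥0∞} (hF : Measurable F) :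
    ∫⁻ σ, F (severedFlow hB1 Λ t σ) ∂μ = ∫⁻ σ, F σ ∂μ :=
  (measurePreserving_severedFlow_of_isChainGibbsMeasure hU hV hB1 Λ hμ t).lintegral_comp hF

end OscillatorChain

end Literature.MathematicalPhysics.KineticTheory.HeatConduction

end
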